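import Literature.RingTheory.AdicTopology.AdicTowerTricky
import HarnessLib

/-!
# Limits of pro-isomorphisms of towers, and uniform torsion bounds for the levels of a limit map

Two pieces of elementary algebra behind the "push-pull" lemma of Grothendieck's existence theorem
(The Stacks Project, Tag 088B, and Remark 087Z "kernel and cokernel annihilated by"):

* `CompletedLimit.map_bijective_of_shift` — **a morphism of towers with essentially zero kernel and
  cokernel (uniform shift `c`) induces a bijection on limits**: if `u_{c+n}(x) = 0` forces the image
  of `x` in `P_n` to vanish (Artin–Rees half) and every `y ∈ N_{c+n}` maps into `im u_n` in `N_n`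
  (Mittag-Leffler half), then `lim u : lim P_n → lim N_n` is bijective — applied to
  `(M/aⁿ⁺¹M)_n → (Γ(X, 𝒢/aⁿ⁺¹𝒢))_n` this is the theorem on formal functions over a non-complete base
  in the form `M^ ≅ lim Γ(X, 𝒢/aⁿ⁺¹𝒢)`;
* `exists_mem_range_level_of_torsion_coker`, `smul_smul_eq_zero_of_level_ker` — **torsion bounds for
  the levels** (Tag 087Z, elementary form): for a linear map `α : N → M'` whose kernel and cokernel are
  killed by `Kᵗ`, and compatible surjections `N ↠ N_n`, `M' ↠ M̄_n` with `ker (M' ↠ M̄_n) = bⁿ⁺¹M'`,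
  `bⁿ⁺¹N_n = 0`, the level map `α_n : N_n → M̄_n` has cokernel killed by `Kᵗ` and kernel killed by
  `K²ᵗ`;
* small complements on iterated transitions (`iter_iter`, `iter_succ_self`).

Everything is proved; no named facts.

## References

* The Stacks Project, Tags 088B (Lemma 30.27.2), 087Z (Remark 30.26.?: kernel/cokernel annihilated
  by an ideal), 02OC. [StacksProject]
* U. Görtz, T. Wedhorn, *Algebraic Geometry II: Cohomology of Schemes*, Springer Spektrum (2023),
  Thm. 24.37, Prop. 24.91, Rem. 24.92 (pp. 525, 565). [GortzWedhorn2023]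
-/

noncomputable section

universe u v w

open Function

namespace Literature.RingTheory.AdicTopology

open AdicCompletion

/-! ### Iterated transitions: complements -/

section Iter

variable {B : Type u} [CommRing B] {P : ℕ → Type v} [∀ n, AddCommGroup (P n)] [∀ n, Module B (P n)]
  (s : ∀ n, P (n + 1) →ₗ[B] P n)

/-- `iter` at `n ≤ n + 1` is `s n`. [folklore] -/
theorem iter_succ_self (n : ℕ) (x : P (n + 1)) : iter s (Nat.le_succ n) x = s n x := by
  rw [show (Nat.le_succ n) = Nat.le_succ_of_le (le_refl n) from rfl, iter_succ_apply s (le_refl n),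
    iter_self, LinearMap.id_apply]

/-- **Transitivity of the iterated transitions**: `iter (n ≤ m) ∘ iter (m ≤ k) = iter (n ≤ k)`. [folklore] -/
theorem iter_iter {n m k : ℕ} (h₁ : n ≤ m) (h₂ : m ≤ k) (x : P k) :
    iter s h₁ (iter s h₂ x) = iter s (h₁.trans h₂) x := by
  induction k, h₂ using Nat.le_induction with
  | base => rw [iter_self, LinearMap.id_apply]
  | succ k hmk ih =>
    rw [iter_succ_apply s hmk, ih,
      show (h₁.trans (Nat.le_succ_of_le hmk) : n ≤ k + 1) = Nat.le_succ_of_le (h₁.trans hmk) from rfl,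
      iter_succ_apply s (h₁.trans hmk)]

end Iter

/-! ### Limits of pro-isomorphisms -/

section ProIso

variable {B : Type u} [CommRing B] (I : Ideal B)
  {P : ℕ → Type v} [∀ n, AddCommGroup (P n)] [∀ n, Module B (P n)]
  [∀ n, Module (B ⧸ I ^ (n + 1)) (P n)] [∀ n, IsScalarTower B (B ⧸ I ^ (n + 1)) (P n)]
  {N : ℕ → Type w} [∀ n, AddCommGroup (N n)] [∀ n, Module B (N n)]
  [∀ n, Module (B ⧸ I ^ (n + 1)) (N n)] [∀ n, IsScalarTower B (B ⧸ I ^ (n + 1)) (N n)]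
  (s : ∀ n, P (n + 1) →ₗ[B] P n) (t : ∀ n, N (n + 1) →ₗ[B] N n)
  (u : ∀ n, P n →ₗ[B] N n) (hu : ∀ n, t n ∘ₗ u (n + 1) = u n ∘ₗ s n) (c : ℕ)

include hu in
/-- **A pro-isomorphism induces a bijection on limits.** If (AR) `u_{c+n} x = 0` implies that the image
of `x` in `P_n` vanishes, and (ML) the image in `N_n` of every `y ∈ N_{c+n}` lies in `im u_n`, then
`lim u` is bijective. [cite: StacksProject, Tag 088B] [cite: GortzWedhorn2023, Thm. 24.37 (p. 525)] -/
theorem CompletedLimit.map_bijective_of_shift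
    (hAR : ∀ (n : ℕ) (x : P (c + n)), u (c + n) x = 0 → iter s (Nat.le_add_left n c) x = 0)
    (hML : ∀ (n : ℕ) (y : N (c + n)), ∃ x : P n, u n x = iter t (Nat.le_add_left n c) y) :
    Bijective (CompletedLimit.map I s t u hu) := by
  constructor
  · refine (injective_iff_map_eq_zero _).mpr fun z hz => CompletedLimit.ext fun n => ?_
    have h0 : ∀ m, u m (z.val m) = 0 := fun m => by
      rw [← CompletedLimit.val_map I s t u hu, hz]; rfl
    change CompletedLimit.proj I s n z = 0
    rw [← iter_proj I s (Nat.le_add_left n c) z]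
    exact hAR n _ (h0 (c + n))
  · intro y
    choose x' hx' using fun n => hML n (y.val (c + n))
    -- `x_n := image of x'_{c+n}` is a compatible family mapping to `y`
    have hy : ∀ {n m} (h : n ≤ m), iter t h (y.val m) = y.val n := fun h => by
      rw [← CompletedLimit.proj_apply, ← CompletedLimit.proj_apply, iter_proj]
    have hux' : ∀ n, u (c + n) (x' (c + n)) = y.val (c + n) := fun n => by
      rw [hx', hy]
    have key : ∀ n, iter s (Nat.le_add_left n c)
        (iter s (Nat.le_succ (c + n)) (x' (c + n + 1)) - x' (c + n)) = 0 := fun n => by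
      apply hAR n
      rw [map_sub, u_iter s t u hu, hx' (c + n + 1), hux' n, iter_iter, hy, sub_self]
    refine ⟨CompletedLimit.mk I s (fun n => iter s (Nat.le_add_left n c) (x' (c + n))) fun n => ?_, ?_⟩
    · have h := key n
      rw [map_sub, sub_eq_zero, iter_iter] at h
      rw [← iter_succ_self s n, iter_iter]
      exact h
    · refine CompletedLimit.ext fun n => ?_
      rw [CompletedLimit.val_map, CompletedLimit.val_mk, u_iter s t u hu, hux' n, hy]

end ProIso

/-! ### Torsion bounds for the levels of a limit map (Stacks 087Z, elementary form) -/

section Levels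

variable {R : Type u} [CommRing R] {N M' Nn Mn : Type*} [AddCommGroup N] [Module R N]
  [AddCommGroup M'] [Module R M'] [AddCommGroup Nn] [Module R Nn] [AddCommGroup Mn] [Module R Mn]
  (α : N →ₗ[R] M') (p : N →ₗ[R] Nn) (p' : M' →ₗ[R] Mn) (αn : Nn →ₗ[R] Mn)
  (hcomm : αn ∘ₗ p = p' ∘ₗ α) {K : Ideal R} {t : ℕ}

include hcomm in
/-- **Cokernel of the level map**: if `Kᵗ·M' ⊆ im α` and `M' → M̄_n` is surjective, then
`Kᵗ·M̄_n ⊆ im α_n`. [cite: StacksProject, Tag 087Z] -/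
theorem exists_mem_range_level_of_torsion_coker (hp' : Surjective p')
    (hQ : ∀ k ∈ K ^ t, ∀ m : M', ∃ x : N, k • m = α x) (k : R) (hk : k ∈ K ^ t) (m : Mn) :
    ∃ x : Nn, k • m = αn x := by
  obtain ⟨m, rfl⟩ := hp' m
  obtain ⟨x, hx⟩ := hQ k hk m
  refine ⟨p x, ?_⟩
  rw [← map_smul, hx, ← LinearMap.comp_apply, ← hcomm, LinearMap.comp_apply]

include hcomm in
/-- **Kernel of the level map**: if `Kᵗ` kills `ker α` and `Kᵗ·M' ⊆ im α`, `N → N_n` is surjective,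
`ker (M' → M̄_n) ⊆ b·M'` for an element `b` killing `N_n`, then `K²ᵗ` kills `ker α_n`: for
`k₁, k₂ ∈ Kᵗ` and `x ∈ ker α_n` one has `(k₁k₂)·x = 0`. [cite: StacksProject, Tag 087Z] -/
theorem smul_smul_eq_zero_of_level_ker (hp : Surjective p) {b : R}
    (hker : ∀ m : M', p' m = 0 → ∃ m₀ : M', m = b • m₀) (hb : ∀ z : Nn, b • z = 0)
    (hT : ∀ k ∈ K ^ t, ∀ x : N, α x = 0 → k • x = 0)
    (hQ : ∀ k ∈ K ^ t, ∀ m : M', ∃ x : N, k • m = α x)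
    (k₁ : R) (hk₁ : k₁ ∈ K ^ t) (k₂ : R) (hk₂ : k₂ ∈ K ^ t) (x : Nn) (hx : αn x = 0) :
    (k₁ * k₂) • x = 0 := by
  obtain ⟨x, rfl⟩ := hp x
  have h1 : p' (α x) = 0 := by
    rw [← LinearMap.comp_apply, ← hcomm, LinearMap.comp_apply, hx]
  obtain ⟨m₀, hm₀⟩ := hker _ h1
  obtain ⟨n₀, hn₀⟩ := hQ k₂ hk₂ m₀
  have h2 : α (k₂ • x - b • n₀) = 0 := by
    rw [map_sub, map_smul, map_smul, hm₀, ← hn₀, smul_comm, sub_self]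
  have h3 := hT k₁ hk₁ _ h2
  rw [smul_sub, sub_eq_zero, smul_smul, smul_comm] at h3
  rw [← map_smul, h3, map_smul, hb]

end Levels

end Literature.RingTheory.AdicTopology

end
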